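import Summits.ABC.IUTFork.Conditional.AbcOfSHregSplitBadRadical
import Literature.NumberTheory.Sieve.SelbergSymmetryFormula
import HarnessLib

/-!
# Branch C, TARGET #1: the CONE binder `hreg` ⟹ `rad((4^{m+1}+1)(4^m+1)) ≥ 4^{(1/3 − ε)(m+1)}` for all large `m`
# (abc-iut cell, R2 S-chain team, seat abc-iut-s2-p3 gen 2; the `ε`-form of `AbcOfSHregSplitBadRadical`)

Record-only PROOF file (D-0012) of the abc-iut cell; TAKES NO SIDE on [IUTchIII] Cor. 3.12 or [IUTchIV] Thm. 1.10.
S. Mochizuki, *IUT IV* [Mochizuki2012], Thm. 1.10 pp. 22–31, Cor. 2.2 (ii) proof (P1)–(P7) pp. 44–47 [claim: Mochizuki2012, status: disputed]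
for the IUT quotations; the content of THIS file is real analysis (the tree's `log x ≤ 2√x`, `Literature.NumberTheory.Sieve.SelbergSymmetry.log_le_two_mul_sqrt`; a Young-type inequality) over the explicit inequality
`Conditional.log_radical_lower_bound_of_hreg_of` of the parent file.

* `SplitBadWindow.pow_seven_le` (`v^7 ≤ t·v^8 + t^{−7}`), `SplitBadWindow.log_radical_le`
  (`log rad((4^{m+1}+1)(4^m+1)) ≤ 2(m+1)·log 4`);
* `SplitBadWindow.radical_bound_reduction` — the parent inequality at `(P_m, l)` with `h^{1/2} ≤ l ≤ 10δ₂·h^{1/2}·log(2δ₂h)`, `7 ≤ l`,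
  `m + 1 ≤ h` implies `log rad ≥ (1/3)(m+1)·log 4 − K·h^{7/8} − C₀` with `K, C₀` explicit in `δ₂, d*, η, log-diff` (`h^{1/8} = √√√h`);
* **`Conditional.log_radical_ge_of_hreg_of`** (any model `F ∋ i` of `ℚ(i)`) and **`Conditional.log_radical_ge_of_hreg`** — `hreg` VERBATIM
  (the CONE binder of `Conditional.abc_of_S_v4` p431657 = of the S_H line of record `abc_of_SH_v6K` p437297, byte-identical) ⟹ for every
  `ε > 0` there is `m₁` with `(1/3 − ε)·(m+1)·log 4 ≤ log rad((4^{m+1}+1)·(4^m+1))` for all `m ≥ m₁`;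
  **`Conditional.radical_ge_rpow_of_hreg`** — the same as `4^{(1/3 − ε)(m+1)} ≤ rad((4^{m+1}+1)(4^m+1))`.

READING (for the planners; nothing asserted about print or any author). A statement about the integers `4^n + 1` ONLY: the CONE binder of the
S_H line of record implies an effective abc-type lower bound for the radical of `(4^m+1)(4^{m+1}+1)`, exponent `1/3 − ε`, for all large `m`
(`m₁` depends on `ε` and on the tree's ineffective (P6) threshold `H_K` of `Cor22.condP6_of_seven_le`). Unconditionally such bounds are far out of
reach (Stewart–Yu-type results give `log rad ≫ (log m)`-strength); under abc the exponent would be `1 − ε`. This is the TARGET #1 obstruction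
certificate in its most explicit form: closing `hreg` in the kernel proves this Diophantine statement. HONEST SCOPE: consequences of the typed
binder; typed ≠ proved; no side taken. PROOF-ONLY file: no definitions, no `Prop` facts.
[cite: Mochizuki2012, IUTchIV Thm. 1.10 pp. 22–31] [cite: Mochizuki2012, IUTchIV Cor. 2.2 (ii) proof (P1)–(P7) p. 44–47]
-/

noncomputable section

namespace Summit.ABC.IUTFork

open NumberField IsDedekindDomain Finset
open Literature.IUT.HodgeTheaters Literature.IUT.LogVolume Literature.IUT.LogVolume.Cor22
open Literature.NumberTheory.DiophantineGeometry Literature.NumberTheory.DiophantineGeometry.GenEll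
open Summit.ABC.ABC.Theorems
open scoped Classical

namespace SplitBadWindow

/-! ## §1. Real-variable lemmas -/

/-- Young-type inequality `v^7 ≤ t·v^8 + t^{−7}` (`v ≥ 0`, `t > 0`): if `v ≥ 1/t` then `v^7 ≤ t·v·v^7`, else `v^7 < t^{−7}`. [folklore] -/
theorem pow_seven_le {v t : ℝ} (hv : 0 ≤ v) (ht : 0 < t) : v ^ 7 ≤ t * v ^ 8 + t⁻¹ ^ 7 := by
  have ht7 : 0 < t⁻¹ ^ 7 := by positivity
  rcases le_or_gt t⁻¹ v with h | h
  · have h1 : 1 ≤ t * v := by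
      have := mul_le_mul_of_nonneg_left h ht.le
      rwa [mul_inv_cancel₀ ht.ne'] at this
    have h7 : 0 ≤ v ^ 7 := by positivity
    nlinarith
  · have h2 : v ^ 7 < t⁻¹ ^ 7 := pow_lt_pow_left₀ h hv (by norm_num)
    have h8 : 0 ≤ t * v ^ 8 := by positivity
    linarith

/-- `log rad((4^{m+1}+1)(4^m+1)) ≤ 2(m+1)·log 4` (`rad n ≤ n ≤ 4^{2m+2}`). [folklore] -/
theorem log_radical_le (m : ℕ) :
    Real.log (UniqueFactorizationMonoid.radical ((4 ^ (m + 1) + 1) * (4 ^ m + 1)) : ℕ) ≤ 2 * ((m : ℝ) + 1) * Real.log 4 := by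
  set N : ℕ := (4 ^ (m + 1) + 1) * (4 ^ m + 1) with hN
  have hN0 : N ≠ 0 := by positivity
  have hrad : (UniqueFactorizationMonoid.radical N : ℕ) ≤ N := Nat.le_of_dvd (Nat.pos_of_ne_zero hN0) UniqueFactorizationMonoid.radical_dvd_self
  have hNle : N ≤ 4 ^ (2 * (m + 1)) := by
    have h1 : 4 ^ (m + 1) + 1 ≤ 2 * 4 ^ (m + 1) := by
      have : 1 ≤ 4 ^ (m + 1) := Nat.one_le_pow _ _ (by norm_num); omega
    have h2 : 4 ^ m + 1 ≤ 2 * 4 ^ m := by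
      have : 1 ≤ 4 ^ m := Nat.one_le_pow _ _ (by norm_num); omega
    calc N = (4 ^ (m + 1) + 1) * (4 ^ m + 1) := hN
      _ ≤ (2 * 4 ^ (m + 1)) * (2 * 4 ^ m) := Nat.mul_le_mul h1 h2
      _ = 4 ^ (2 * (m + 1)) := by ring
  have hr0 : (0 : ℝ) < (UniqueFactorizationMonoid.radical N : ℕ) := by
    exact_mod_cast Nat.pos_of_ne_zero UniqueFactorizationMonoid.radical_ne_zero
  calc Real.log (UniqueFactorizationMonoid.radical N : ℕ)
      ≤ Real.log ((4 : ℝ) ^ (2 * (m + 1))) := by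
        apply Real.log_le_log hr0
        exact_mod_cast hrad.trans hNle
    _ = 2 * ((m : ℝ) + 1) * Real.log 4 := by rw [Real.log_pow]; push_cast; ring

/-- **Reduction of the explicit display to `log rad ≥ (1/3)(m+1)·log 4 − K·h^{7/8} − C₀`.** Pure real algebra: from `7 ≤ l`, `h ≥ 1`,
`h^{1/2} ≤ l ≤ 10δ·h^{1/2}·log(2δh)` (`δ ≥ 1`), `m + 1 ≤ h`, `0 ≤ D`, `0 ≤ R ≤ 2(m+1)·log 4` and the display
`(1/3)·log(1+4^{m+1}) − (1/3)·h^{1/2}·log l − 80·d*·l − 40·η ≤ (1 + 40/l)·(2D + R)`, with `v := √√√h` (`v^8 = h`):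
`R ≥ (1/3)(m+1)·log 4 − K·v^7 − (40η + 14D)`, `K = (2/3)·√(40δc) + 3200·d*·δ·c + 120`, `c = √√(2δ)`. [folklore] -/
theorem radical_bound_reduction {δ dstar η D R h l : ℝ} {m : ℕ} (hδ : 1 ≤ δ) (hds : 0 ≤ dstar) (hD : 0 ≤ D) (hR0 : 0 ≤ R)
    (hR : R ≤ 2 * ((m : ℝ) + 1) * Real.log 4) (hl7 : 7 ≤ l) (hh : ((m : ℝ) + 1) ≤ h)
    (hlo : Real.sqrt h ≤ l) (hhi : l ≤ 10 * δ * Real.sqrt h * Real.log (2 * δ * h))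
    (hdisp : 1 / 3 * Real.log (1 + 4 ^ (m + 1)) - 1 / 3 * Real.sqrt h * Real.log l - 80 * dstar * l - 40 * η ≤
      (1 + 40 / l) * (2 * D + R)) :
    1 / 3 * ((m : ℝ) + 1) * Real.log 4
        - ((2 / 3 * Real.sqrt (40 * δ * Real.sqrt (Real.sqrt (2 * δ))) + 3200 * dstar * δ * Real.sqrt (Real.sqrt (2 * δ)) + 120)
            * Real.sqrt (Real.sqrt (Real.sqrt h)) ^ 7)
        - (40 * η + 14 * D) ≤ R := by
  have hm0 : (0 : ℝ) ≤ m := Nat.cast_nonneg m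
  have hh1 : 1 ≤ h := by linarith
  have hh0 : 0 < h := by linarith
  have hl0 : 0 < l := by linarith
  have hlog4 : Real.log 4 < 3 / 2 := by
    have h4 : Real.log 4 = 2 * Real.log 2 := by
      have h := Real.log_pow 2 2
      norm_num at h
      exact h
    rw [h4]
    have := Real.log_two_lt_d9
    linarith
  -- the nested square roots `v = h^{1/8}`, `c = (2δ)^{1/4}`
  set v : ℝ := Real.sqrt (Real.sqrt (Real.sqrt h)) with hv
  set c : ℝ := Real.sqrt (Real.sqrt (2 * δ)) with hc
  have hv0 : 0 ≤ v := Real.sqrt_nonneg _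
  have hc0 : 0 ≤ c := Real.sqrt_nonneg _
  have hs0 : 0 ≤ Real.sqrt h := Real.sqrt_nonneg _
  have hss0 : 0 ≤ Real.sqrt (Real.sqrt h) := Real.sqrt_nonneg _
  have hv2 : v ^ 2 = Real.sqrt (Real.sqrt h) := Real.sq_sqrt hss0
  have hu2 : Real.sqrt (Real.sqrt h) ^ 2 = Real.sqrt h := Real.sq_sqrt hs0
  have hs2 : Real.sqrt h ^ 2 = h := Real.sq_sqrt hh0.le
  have hv4 : v ^ 4 = Real.sqrt h := by
    rw [show v ^ 4 = (v ^ 2) ^ 2 by ring, hv2, hu2]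
  have hv8 : v ^ 8 = h := by
    rw [show v ^ 8 = (v ^ 4) ^ 2 by ring, hv4, hs2]
  have hv1 : 1 ≤ v := by
    rw [hv, ← Real.sqrt_one]
    apply Real.sqrt_le_sqrt
    rw [← Real.sqrt_one]
    apply Real.sqrt_le_sqrt
    rw [← Real.sqrt_one]
    exact Real.sqrt_le_sqrt hh1
  have hv4pos : 0 < v ^ 4 := by positivity
  have hv67 : v ^ 6 ≤ v ^ 7 := pow_le_pow_right₀ hv1 (by norm_num)
  have hv47 : v ^ 4 ≤ v ^ 7 := pow_le_pow_right₀ hv1 (by norm_num)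
  -- `log(2δh) ≤ 4·c·v²`
  have hL : Real.log (2 * δ * h) ≤ 4 * c * v ^ 2 := by
    -- `log x ≤ 4·√√x` (the tree's `log u ≤ 2√u`, applied to `√x`)
    have h1 : Real.log (2 * δ * h) ≤ 4 * Real.sqrt (Real.sqrt (2 * δ * h)) := by
      have hx : 0 < 2 * δ * h := by positivity
      have hs : 0 < Real.sqrt (2 * δ * h) := Real.sqrt_pos.mpr hx
      have h1 := Literature.NumberTheory.Sieve.SelbergSymmetry.log_le_two_mul_sqrt hs
      have h2 : Real.log (2 * δ * h) = 2 * Real.log (Real.sqrt (2 * δ * h)) := by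
        rw [Real.log_sqrt hx.le]; ring
      linarith
    have h2 : Real.sqrt (Real.sqrt (2 * δ * h)) = c * Real.sqrt (Real.sqrt h) := by
      rw [hc, Real.sqrt_mul (by positivity) h, Real.sqrt_mul (Real.sqrt_nonneg _)]
    rw [h2, ← hv2] at h1
    linarith
  -- `l ≤ 40·δ·c·v⁶`
  have hl6 : l ≤ 40 * δ * c * v ^ 6 := by
    rw [← hv4] at hhi
    have h1 : 10 * δ * v ^ 4 * Real.log (2 * δ * h) ≤ 10 * δ * v ^ 4 * (4 * c * v ^ 2) :=
      mul_le_mul_of_nonneg_left hL (by positivity)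
    calc l ≤ 10 * δ * v ^ 4 * Real.log (2 * δ * h) := hhi
      _ ≤ 10 * δ * v ^ 4 * (4 * c * v ^ 2) := h1
      _ = 40 * δ * c * v ^ 6 := by ring
  -- `log l ≤ 2·√(40δc)·v³`
  have hlogl : Real.log l ≤ 2 * Real.sqrt (40 * δ * c) * v ^ 3 := by
    have h1 := Literature.NumberTheory.Sieve.SelbergSymmetry.log_le_two_mul_sqrt hl0
    have h2 : Real.sqrt l ≤ Real.sqrt (40 * δ * c * v ^ 6) := Real.sqrt_le_sqrt hl6
    have h3 : Real.sqrt (40 * δ * c * v ^ 6) = Real.sqrt (40 * δ * c) * v ^ 3 := by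
      rw [Real.sqrt_mul (by positivity), show v ^ 6 = (v ^ 3) ^ 2 by ring, Real.sqrt_sq (by positivity)]
    rw [h3] at h2
    linarith
  -- error term 1: `(1/3)·√h·log l ≤ (2/3)·√(40δc)·v⁷`
  have hE1 : 1 / 3 * Real.sqrt h * Real.log l ≤ 2 / 3 * Real.sqrt (40 * δ * c) * v ^ 7 := by
    rw [← hv4]
    calc 1 / 3 * v ^ 4 * Real.log l ≤ 1 / 3 * v ^ 4 * (2 * Real.sqrt (40 * δ * c) * v ^ 3) :=
          mul_le_mul_of_nonneg_left hlogl (by positivity)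
      _ = 2 / 3 * Real.sqrt (40 * δ * c) * v ^ 7 := by ring
  -- error term 2: `80·d*·l ≤ 3200·d*·δ·c·v⁷`
  have hE2 : 80 * dstar * l ≤ 3200 * dstar * δ * c * v ^ 7 := by
    calc 80 * dstar * l ≤ 80 * dstar * (40 * δ * c * v ^ 6) := mul_le_mul_of_nonneg_left hl6 (by positivity)
      _ = 3200 * dstar * δ * c * v ^ 6 := by ring
      _ ≤ 3200 * dstar * δ * c * v ^ 7 := mul_le_mul_of_nonneg_left hv67 (by positivity)
  -- error term 3: `(1 + 40/l)(2D + R) ≤ R + 14 D + 120 v⁷`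
  have hE3 : (1 + 40 / l) * (2 * D + R) ≤ R + 14 * D + 120 * v ^ 7 := by
    set w : ℝ := 40 / l with hw
    have hw0 : 0 ≤ w := by positivity
    have hw7 : w ≤ 40 / 7 := div_le_div_of_nonneg_left (by norm_num) (by norm_num) hl7
    have hwv : w ≤ 40 / v ^ 4 := by
      rw [← hv4] at hlo
      exact div_le_div_of_nonneg_left (by norm_num) hv4pos hlo
    have hRh : R ≤ 3 * v ^ 8 := by rw [hv8]; nlinarith
    have hp1 : w * (2 * D) ≤ 40 / 7 * (2 * D) := mul_le_mul_of_nonneg_right hw7 (by positivity)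
    have hp2 : w * R ≤ 120 * v ^ 4 := by
      calc w * R ≤ 40 / v ^ 4 * R := mul_le_mul_of_nonneg_right hwv hR0
        _ ≤ 40 / v ^ 4 * (3 * v ^ 8) := mul_le_mul_of_nonneg_left hRh (by positivity)
        _ = 120 * v ^ 4 := by
            field_simp
            ring
    have e : (1 + w) * (2 * D + R) = 2 * D + R + w * (2 * D) + w * R := by ring
    rw [e]
    linarith
  -- `log(1 + 4^{m+1}) ≥ (m+1) log 4`
  have hlog : ((m : ℝ) + 1) * Real.log 4 ≤ Real.log (1 + 4 ^ (m + 1)) := by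
    have : Real.log ((4 : ℝ) ^ (m + 1)) ≤ Real.log (1 + 4 ^ (m + 1)) :=
      Real.log_le_log (by positivity) (by linarith [pow_pos (show (0:ℝ) < 4 by norm_num) (m + 1)])
    rw [Real.log_pow] at this; push_cast at this; linarith
  have e : (2 / 3 * Real.sqrt (40 * δ * c) + 3200 * dstar * δ * c + 120) * v ^ 7 =
      2 / 3 * Real.sqrt (40 * δ * c) * v ^ 7 + 3200 * dstar * δ * c * v ^ 7 + 120 * v ^ 7 := by ring
  rw [e]
  linarith

end SplitBadWindow

/-! ## §2. `hreg` ⟹ `rad((4^{m+1}+1)(4^m+1)) ≥ 4^{(1/3 − ε)(m+1)}` eventually -/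

namespace Conditional

open SplitBadWitness SplitBadWindow

/-- **`hreg` ⟹ `log rad((4^{m+1}+1)(4^m+1)) ≥ (1/3 − ε)(m+1)·log 4` for all large `m`** (any model `F` of `ℚ(i)`, `i = ζ`). From the parent
inequality at the admissible window prime: `log rad ≥ (1/3)(m+1) log 4 − K·h_m^{7/8} − C₀` (`radical_bound_reduction`), `h_m ≤ A + B·m`, and
`K·v^7 ≤ K(t·v^8 + t^{−7})` with `t = ε·log 4/(6(KB+1))`. Nothing asserted about any point, about print, or about any author; typed ≠ proved.
[cite: Mochizuki2012, IUTchIV Thm. 1.10 pp. 22–31] [cite: Mochizuki2012, IUTchIV Cor. 2.2 (ii) proof (P1)–(P7) p. 44–47] [claim: Mochizuki2012, status: disputed] -/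
theorem log_radical_ge_of_hreg_of (F : Type) [Field F] [NumberField F] [IsCyclotomicExtension {4} ℚ F]
    {ζ : 𝓞 F} (hζ : IsPrimitiveRoot ζ 4)
    (hreg : ∀ P : NFPoint, P ∈ UP → ∀ l : ℕ, l.Prime → 5 ≤ l →
      Cor22.AdmitsCore P → Cor22.CondP2 P l → Cor22.CondP5 P l → Cor22.CondP6 P l →
      ∀ T : Cor22.ThetaVolumeDatumAt P l,
        (letI := T.instFieldF; letI := T.instNumberFieldF; letI := T.instAlgebraF; letI := T.instFieldK
         letI := T.instNumberFieldK; letI := T.instAlgebraK; letI := T.instFieldFbar; letI := T.instAlgebraFbar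
         letI := T.instAlgebraKFbar; letI := T.instIsElliptic
         ¬ (∀ p ∈ T.I.supportPrimes, ∀ v w : placesOver (fieldOfModuli T.E) p,
            (Summit.ABC.IUTFork.DHData.ofInput T.I).logQloc p v = (Summit.ABC.IUTFork.DHData.ofInput T.I).logQloc p w)) →
        T.HullEstimateOf
          (((l : ℝ) + 1) / 4 *
            ((1 + 12 * (Cor22.dmod P : ℝ) / l) * (P.logDiff + Cor22.logCondAvoid P {2, l})
              + 2 * Real.log l + 52
              + 20 / 3 * Real.log (((2 ^ 12 * 3 ^ 3 * 5 * Cor22.dmod P : ℕ) : ℝ) * (l : ℝ))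
                * (Nat.primeCounting (2 ^ 12 * 3 ^ 3 * 5 * Cor22.dmod P * l) : ℝ))))
    {ε : ℝ} (hε : 0 < ε) :
    ∃ m₁ : ℕ, ∀ m : ℕ, m₁ ≤ m →
      (1 / 3 - ε) * ((m : ℝ) + 1) * Real.log 4 ≤
        Real.log (UniqueFactorizationMonoid.radical ((4 ^ (m + 1) + 1) * (4 ^ m + 1)) : ℕ) := by
  obtain ⟨η, hη⟩ := exists_isEtaPrm
  obtain ⟨A, B, m₀, hA, hB, hmain⟩ := log_radical_lower_bound_of_hreg_of F hζ hreg hη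
  have hlog4 : 0 < Real.log 4 := Real.log_pos (by norm_num)
  have hη0 : 0 < η := hη.1
  -- the constants of the reduction
  set δ : ℝ := delta 2 with hδdef
  have hδ1 : 1 ≤ δ := by rw [hδdef]; simp [delta]; norm_num
  set c : ℝ := Real.sqrt (Real.sqrt (2 * δ)) with hc
  set K : ℝ := 2 / 3 * Real.sqrt (40 * δ * c) + 3200 * (2 ^ 12 * 3 ^ 3 * 5) * δ * c + 120 with hK
  have hK0 : 0 ≤ K := by positivity
  set D : ℝ := (⟨F, (0 : F)⟩ : NFPoint).logDiff with hD
  have hD0 : 0 ≤ D := NFPoint.logDiff_nonneg _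
  set C₀ : ℝ := 40 * η + 14 * D with hC₀
  have hC₀0 : 0 ≤ C₀ := by positivity
  -- Young parameter and threshold
  set t : ℝ := ε * Real.log 4 / (6 * (K * B + 1)) with ht
  have hKB : 0 < K * B + 1 := by positivity
  have ht0 : 0 < t := by positivity
  have htKB : K * B * t ≤ ε * Real.log 4 / 6 := by
    rw [ht]
    have : K * B * (ε * Real.log 4 / (6 * (K * B + 1))) = (K * B / (K * B + 1)) * (ε * Real.log 4 / 6) := by
      field_simp
    rw [this]
    have h1 : K * B / (K * B + 1) ≤ 1 := by rw [div_le_one hKB]; linarith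
    exact mul_le_of_le_one_left (by positivity) h1
  set M : ℝ := (K * t * A + K * t⁻¹ ^ 7 + C₀) / (5 * ε * Real.log 4 / 6) with hM
  refine ⟨max m₀ ⌈M⌉₊, fun m hm => ?_⟩
  have hm0 : m₀ ≤ m := (le_max_left _ _).trans hm
  have hmM : M ≤ m := le_trans (Nat.le_ceil _) (by exact_mod_cast (le_max_right _ _).trans hm)
  obtain ⟨l, hlp, hl7, -, -, -, hlo, hhi, hh, hhA, hdisp⟩ := hmain m hm0
  set h : ℝ := logQForall (⟨F, (ζ : F) * 2 ^ m / (1 + (ζ : F) * 2 ^ (m + 1))⟩ : NFPoint) with hhdef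
  set R : ℝ := Real.log (UniqueFactorizationMonoid.radical ((4 ^ (m + 1) + 1) * (4 ^ m + 1)) : ℕ) with hRdef
  have hR0 : 0 ≤ R := Real.log_nonneg (by
    exact_mod_cast Nat.one_le_iff_ne_zero.mpr UniqueFactorizationMonoid.radical_ne_zero)
  have hRle : R ≤ 2 * ((m : ℝ) + 1) * Real.log 4 := log_radical_le m
  have hl7' : (7 : ℝ) ≤ l := by exact_mod_cast hl7
  have hDm : (⟨F, (ζ : F) * 2 ^ m / (1 + (ζ : F) * 2 ^ (m + 1))⟩ : NFPoint).logDiff = D := rfl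
  rw [hDm] at hdisp
  have hred := radical_bound_reduction (m := m) hδ1 (by positivity : (0 : ℝ) ≤ 2 ^ 12 * 3 ^ 3 * 5) hD0 hR0 hRle hl7' hh hlo hhi hdisp
  rw [← hc, ← hK, ← hC₀] at hred
  -- `v⁸ = h ≤ A + B m`
  set v : ℝ := Real.sqrt (Real.sqrt (Real.sqrt h)) with hv
  have hm0' : (0 : ℝ) ≤ m := Nat.cast_nonneg m
  have hh1 : 1 ≤ h := by linarith
  have hv0 : 0 ≤ v := Real.sqrt_nonneg _
  have hv8 : v ^ 8 = h := by
    have hs0 : 0 ≤ Real.sqrt h := Real.sqrt_nonneg _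
    have hss0 : 0 ≤ Real.sqrt (Real.sqrt h) := Real.sqrt_nonneg _
    have hv2 : v ^ 2 = Real.sqrt (Real.sqrt h) := Real.sq_sqrt hss0
    have hu2 : Real.sqrt (Real.sqrt h) ^ 2 = Real.sqrt h := Real.sq_sqrt hs0
    have hs2 : Real.sqrt h ^ 2 = h := Real.sq_sqrt (by linarith)
    rw [show v ^ 8 = ((v ^ 2) ^ 2) ^ 2 by ring, hv2, hu2, hs2]
  have hyoung := pow_seven_le hv0 ht0
  -- `K v⁷ ≤ K t (A + B m) + K t⁻⁷`
  have hv7 : v ^ 7 ≤ t * (A + B * m) + t⁻¹ ^ 7 := by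
    have : t * v ^ 8 ≤ t * (A + B * m) := by
      rw [hv8]; exact mul_le_mul_of_nonneg_left hhA ht0.le
    linarith
  have hKv : K * v ^ 7 ≤ K * (t * (A + B * m) + t⁻¹ ^ 7) := mul_le_mul_of_nonneg_left hv7 hK0
  -- the threshold: `K t A + K t⁻⁷ + C₀ ≤ (5ε/6) log 4 · m`
  have hthr : K * t * A + K * t⁻¹ ^ 7 + C₀ ≤ 5 * ε * Real.log 4 / 6 * m := by
    have hpos : 0 < 5 * ε * Real.log 4 / 6 := by positivity
    rw [hM, div_le_iff₀ hpos] at hmM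
    linarith
  have hKBm : K * B * t * m ≤ ε * Real.log 4 / 6 * m := mul_le_mul_of_nonneg_right htKB hm0'
  have e : K * (t * (A + B * m) + t⁻¹ ^ 7) = K * t * A + K * B * t * m + K * t⁻¹ ^ 7 := by ring
  rw [e] at hKv
  have hεm : 0 ≤ ε * Real.log 4 := by positivity
  linarith

/-- **THE CONE BINDER OF THE S_H LINE OF RECORD ⟹ `rad((4^{m+1}+1)·(4^m+1)) ≥ 4^{(1/3 − ε)(m+1)}` FOR ALL LARGE `m`.** Assume `hreg`
VERBATIM (`Conditional.abc_of_S_v4` p431657; = the CONE binder of `abc_of_SH_v6K` p437297). Then for every `ε > 0` there is `m₁` such that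
`(1/3 − ε)·(m+1)·log 4 ≤ log rad((4^{m+1}+1)·(4^m+1))` for all `m ≥ m₁` (`ℚ(i) := CyclotomicField 4 ℚ`, `i := ζ₄` in
`log_radical_ge_of_hreg_of`). A statement about the integers `4^n + 1` only; every hypothesis of [IUTchIV] Cor. 2.2 (ii) used on the way
((P2) window prime, (P3), (P5), (P6), `P_m ∈ UP ∩ K_V`, split-badness) is a theorem of the tree. Nothing asserted about print or about any
author; no side taken on [IUTchIII] Cor. 3.12; nothing here asserts `hreg` or abc; typed ≠ proved.
[cite: Mochizuki2012, IUTchIV Thm. 1.10 pp. 22–31] [cite: Mochizuki2012, IUTchIV Cor. 2.2 (ii) proof (P1)–(P7) p. 44–47] [claim: Mochizuki2012, status: disputed] -/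
theorem log_radical_ge_of_hreg
    (hreg : ∀ P : NFPoint, P ∈ UP → ∀ l : ℕ, l.Prime → 5 ≤ l →
      Cor22.AdmitsCore P → Cor22.CondP2 P l → Cor22.CondP5 P l → Cor22.CondP6 P l →
      ∀ T : Cor22.ThetaVolumeDatumAt P l,
        (letI := T.instFieldF; letI := T.instNumberFieldF; letI := T.instAlgebraF; letI := T.instFieldK
         letI := T.instNumberFieldK; letI := T.instAlgebraK; letI := T.instFieldFbar; letI := T.instAlgebraFbar
         letI := T.instAlgebraKFbar; letI := T.instIsElliptic
         ¬ (∀ p ∈ T.I.supportPrimes, ∀ v w : placesOver (fieldOfModuli T.E) p,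
            (Summit.ABC.IUTFork.DHData.ofInput T.I).logQloc p v = (Summit.ABC.IUTFork.DHData.ofInput T.I).logQloc p w)) →
        T.HullEstimateOf
          (((l : ℝ) + 1) / 4 *
            ((1 + 12 * (Cor22.dmod P : ℝ) / l) * (P.logDiff + Cor22.logCondAvoid P {2, l})
              + 2 * Real.log l + 52
              + 20 / 3 * Real.log (((2 ^ 12 * 3 ^ 3 * 5 * Cor22.dmod P : ℕ) : ℝ) * (l : ℝ))
                * (Nat.primeCounting (2 ^ 12 * 3 ^ 3 * 5 * Cor22.dmod P * l) : ℝ))))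
    {ε : ℝ} (hε : 0 < ε) :
    ∃ m₁ : ℕ, ∀ m : ℕ, m₁ ≤ m →
      (1 / 3 - ε) * ((m : ℝ) + 1) * Real.log 4 ≤
        Real.log (UniqueFactorizationMonoid.radical ((4 ^ (m + 1) + 1) * (4 ^ m + 1)) : ℕ) := by
  haveI : IsCyclotomicExtension {4} ℚ (CyclotomicField 4 ℚ) := CyclotomicField.isCyclotomicExtension 4 ℚ
  exact log_radical_ge_of_hreg_of (CyclotomicField 4 ℚ)
    (IsCyclotomicExtension.zeta_spec 4 ℚ (CyclotomicField 4 ℚ)).toInteger_isPrimitiveRoot hreg hε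

/-- **The same in exponential form: `4^{(1/3 − ε)(m+1)} ≤ rad((4^{m+1}+1)(4^m+1))` for all `m ≥ m₁`** (`^` = `Real.rpow`). Nothing asserted about
print or about any author; no side taken; nothing here asserts `hreg` or abc. [cite: Mochizuki2012, IUTchIV Thm. 1.10 pp. 22–31]
[claim: Mochizuki2012, status: disputed] -/
theorem radical_ge_rpow_of_hreg
    (hreg : ∀ P : NFPoint, P ∈ UP → ∀ l : ℕ, l.Prime → 5 ≤ l →
      Cor22.AdmitsCore P → Cor22.CondP2 P l → Cor22.CondP5 P l → Cor22.CondP6 P l →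
      ∀ T : Cor22.ThetaVolumeDatumAt P l,
        (letI := T.instFieldF; letI := T.instNumberFieldF; letI := T.instAlgebraF; letI := T.instFieldK
         letI := T.instNumberFieldK; letI := T.instAlgebraK; letI := T.instFieldFbar; letI := T.instAlgebraFbar
         letI := T.instAlgebraKFbar; letI := T.instIsElliptic
         ¬ (∀ p ∈ T.I.supportPrimes, ∀ v w : placesOver (fieldOfModuli T.E) p,
            (Summit.ABC.IUTFork.DHData.ofInput T.I).logQloc p v = (Summit.ABC.IUTFork.DHData.ofInput T.I).logQloc p w)) →
        T.HullEstimateOf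
          (((l : ℝ) + 1) / 4 *
            ((1 + 12 * (Cor22.dmod P : ℝ) / l) * (P.logDiff + Cor22.logCondAvoid P {2, l})
              + 2 * Real.log l + 52
              + 20 / 3 * Real.log (((2 ^ 12 * 3 ^ 3 * 5 * Cor22.dmod P : ℕ) : ℝ) * (l : ℝ))
                * (Nat.primeCounting (2 ^ 12 * 3 ^ 3 * 5 * Cor22.dmod P * l) : ℝ))))
    {ε : ℝ} (hε : 0 < ε) :
    ∃ m₁ : ℕ, ∀ m : ℕ, m₁ ≤ m →
      (4 : ℝ) ^ ((1 / 3 - ε) * ((m : ℝ) + 1)) ≤ (UniqueFactorizationMonoid.radical ((4 ^ (m + 1) + 1) * (4 ^ m + 1)) : ℕ) := by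
  obtain ⟨m₁, hm₁⟩ := log_radical_ge_of_hreg hreg hε
  refine ⟨m₁, fun m hm => ?_⟩
  have h := hm₁ m hm
  have hr0 : (0 : ℝ) < (UniqueFactorizationMonoid.radical ((4 ^ (m + 1) + 1) * (4 ^ m + 1)) : ℕ) := by
    exact_mod_cast Nat.pos_of_ne_zero UniqueFactorizationMonoid.radical_ne_zero
  rw [Real.rpow_def_of_pos (by norm_num : (0 : ℝ) < 4), ← Real.le_log_iff_exp_le hr0]
  linarith

end Conditional

end Summit.ABC.IUTFork

end
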